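import Literature.NumberTheory.GaloisRepresentations.HeckeCharacterWeakApproximation
import HarnessLib

/-!
# Rigidity of idele class characters with values in any Hausdorff commutative topological group

Topic `NumberTheory/GaloisRepresentations`; namespace `Literature.NumberTheory.GaloisRepresentations`.
Theorems only (no definition, no named fact, no instance).

`HeckeCharacter.eq_one_of_forall_localUnits` (file `HeckeCharacterWeakApproximation`): a Hecke
character (`𝕀_K →ₜ* ℂˣ`, trivial on `Kˣ`) which is trivial on `K_vˣ ⊆ 𝕀_K` for all finite `v`
outside a finite set is trivial — "`Kˣ 𝕀_K^S` is dense in `𝕀_K`", Cassels–Fröhlich VII §4 Prop. 4.1,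
from weak approximation at `S ∪ ∞`.  The proof there uses nothing about `ℂˣ` beyond its being a
Hausdorff commutative topological group; this file records the same statement and proof for
continuous homomorphisms `χ : 𝕀_K →ₜ* G` into ANY such `G` which are trivial on the principal ideles
(`ContinuousMonoidHom.idele_eq_one_of_forall_localUnits`, with the intermediate
`idele_eq_one_of_fst_eq_one`), and the rigidity corollary `idele_eq_of_forall_localUnits`
(two idele class characters agreeing on `K_vˣ` for almost all `v` are equal).  Needed for the
`ℓ`-ADIC avatars `𝕀_K → ℚ̄_ℓˣ` of abelian Galois characters and of algebraic Hecke characters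
(`FramedGaloisRep.exists_idelicCharacter_localGlobal`; Serre, *Abelian ℓ-adic representations*,
Ch. III §2), which are not `ℂˣ`-valued.

## References
* [CasselsFrohlichANT1967] J. Tate, *Global class field theory* (Cassels–Fröhlich Ch. VII), §4
  Prop. 4.1 and its proof; J. W. S. Cassels, *Global fields* (Ch. II), §6 (weak approximation).
-/

noncomputable section

open NumberField IsDedekindDomain Filter Topology

namespace Literature.NumberTheory.GaloisRepresentations

universe u

variable {K : Type u} [Field K] [NumberField K]
variable {G : Type*} [CommGroup G] [TopologicalSpace G] [IsTopologicalGroup G] [T2Space G]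

open HeckeCharacter

omit [IsTopologicalGroup G] in
/-- **A Hecke character trivial on `K_vˣ` for all `v ∉ S` kills the ideles supported off
`S ∪ ∞`.** If `χ ∘ localUnits v = 1` for every finite `v ∉ S`, then `χ z = 1` for every idele `z`
with `z_∞ = 1` and `z_v = 1` for `v ∈ S` (`z` is in the closure of the finite products
`∏_{v ∈ T} localUnits v (z_v)`, `T ∩ S`-factors being trivial, and `ker χ` is closed).
Cassels–Fröhlich, Ch. VII §4, proof of Prop. 4.1 (the factor `ψ((ax)_2)`, `(ax)_2 ∈ J_K^S`).
[cite: CasselsFrohlichANT1967, Ch. VII §4 Prop. 4.1 (proof)] -/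
theorem ContinuousMonoidHom.idele_eq_one_of_fst_eq_one (χ : ideleGroup K →ₜ* G) {S : Set (HeightOneSpectrum (𝓞 K))}
    (h : ∀ v ∉ S, ∀ u : (v.adicCompletion K)ˣ, χ (localUnits v u) = 1)
    (z : ideleGroup K) (hz1 : (z : AdeleRing (𝓞 K) K).1 = 1)
    (hzS : ∀ v ∈ S, (z : AdeleRing (𝓞 K) K).2 v = 1) : χ z = 1 := by
  classical
  have hcl : IsClosed {y : ideleGroup K | χ y = 1} :=
    isClosed_eq (map_continuous χ) continuous_const
  suffices hz : z ∈ closure {y : ideleGroup K | χ y = 1} by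
    rw [hcl.closure_eq] at hz
    exact hz
  rw [mem_closure_iff_nhds]
  intro N hN
  have hN1 : {y : ideleGroup K | z * y ∈ N} ∈ 𝓝 (1 : ideleGroup K) := by
    have : N ∈ 𝓝 (z * 1) := by rwa [mul_one]
    exact (continuous_const_mul z).continuousAt.preimage_mem_nhds this
  obtain ⟨T, hT, e, hTe⟩ := ideleGroup_exists_congruenceSubgroup_subset hN1
  have hT₀ := ideleGroup_valued_snd_eventually_eq_one z
  rw [Filter.eventually_cofinite] at hT₀
  set T' : Finset (HeightOneSpectrum (𝓞 K)) := hT.toFinset ∪ hT₀.toFinset with hT'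
  let u : ∀ q : HeightOneSpectrum (𝓞 K), (q.adicCompletion K)ˣ := fun q =>
    Units.mk0 ((z : AdeleRing (𝓞 K) K).2 q) (ideleGroup_snd_ne_zero z q)
  set zT : ideleGroup K := ∏ q ∈ T', localUnits q (u q) with hzT
  have hχzT : χ zT = 1 := by
    rw [hzT, map_prod]
    refine Finset.prod_eq_one fun q _ => ?_
    by_cases hq : q ∈ S
    · have hu : u q = 1 := Units.ext (by simp [u, hzS q hq])
      rw [hu, map_one, map_one]
    · exact h q hq (u q)
  refine ⟨zT, ?_, hχzT⟩
  have hmem : z * (z⁻¹ * zT) ∈ N := by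
    refine hTe (z⁻¹ * zT) ?_ ?_ ?_
    · rw [ideleGroup_val_fst_mul, fst_prod_localUnits, mul_one]
      have := ideleGroup_val_inv_fst_mul z
      rwa [hz1, mul_one] at this
    · intro v
      rw [ideleGroup_val_snd_mul, ideleGroup_val_inv_snd, snd_prod_localUnits]
      split_ifs with hv
      · rw [Units.val_mk0, inv_mul_cancel₀ (ideleGroup_snd_ne_zero z v), map_one]
      · have hv1 : Valued.v ((z : AdeleRing (𝓞 K) K).2 v) = 1 := by
          by_contra hne
          exact hv (Finset.mem_union_right _ (hT₀.mem_toFinset.2 hne))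
        rw [mul_one, map_inv₀, hv1, inv_one]
    · intro v hv
      have hv' : v ∈ T' := Finset.mem_union_left _ (hT.mem_toFinset.2 hv)
      rw [ideleGroup_val_snd_mul, ideleGroup_val_inv_snd, snd_prod_localUnits, if_pos hv',
        Units.val_mk0, inv_mul_cancel₀ (ideleGroup_snd_ne_zero z v), sub_self, map_zero]
      exact zero_le
  rwa [mul_inv_cancel_left] at hmem

omit [IsTopologicalGroup G] in
/-- **`K^× 𝕀_K^S` is dense in `𝕀_K` (character form): a Hecke character trivial on `K_vˣ` for all
finite `v` outside a finite set `S` is trivial.** Cassels–Fröhlich, Ch. VII (Tate), §4, Prop. 4.1,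
uniqueness, with its printed proof: for `x ∈ J_K` and `a ∈ K^*`,
`ψ(x) = ψ(ax) = ψ((ax)_1) ψ((ax)_2)` where `(ax)_1` keeps the components at `S` (here `S ∪ ∞`) and
`(ax)_2 ∈ J_K^S`; by the weak approximation theorem (Ch. II §6) there are `a_n ∈ K^*` with
`a_n → x⁻¹` at all places of `S`, so `ψ(x) = lim ψ((a_n x)_1) = 1` by continuity. Here:
`denseRange_algebraMap_pi_prod` supplies `a`, `eq_one_of_fst_eq_one` kills `(x a⁻¹)_2`,
`map_principal` kills `a`, and `(x a⁻¹)_1` lies in a prescribed neighbourhood of `1`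
(`ideleGroup_exists_nhds_congruenceSubgroup_subset`), whence `χ x` lies in every neighbourhood of
`1`. [cite: CasselsFrohlichANT1967, Ch. VII §4 Prop. 4.1 (proof)] -/
theorem ContinuousMonoidHom.idele_eq_one_of_forall_localUnits (χ : ideleGroup K →ₜ* G)
    (hprinc : ∀ x ∈ principalIdeles K, χ x = 1) {S : Finset (HeightOneSpectrum (𝓞 K))}
    (h : ∀ v ∉ S, ∀ u : (v.adicCompletion K)ˣ, χ (localUnits v u) = 1) : χ = 1 := by
  classical
  refine ContinuousMonoidHom.ext fun x => ?_
  rw [ContinuousMonoidHom.coe_one, Pi.one_apply]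
  suffices hmain : ∀ W ∈ 𝓝 (1 : G), χ x ∈ W by
    by_contra hx
    exact hmain {w | w ≠ χ x} (isOpen_ne.mem_nhds (Ne.symm hx)) rfl
  intro W hW
  have hN : χ ⁻¹' W ∈ 𝓝 (1 : ideleGroup K) :=
    (map_continuous χ).continuousAt.preimage_mem_nhds (by rwa [map_one])
  obtain ⟨U₁, hU₁, T, hT, e, hTe⟩ := ideleGroup_exists_nhds_congruenceSubgroup_subset hN
  -- notation
  set xinf : InfiniteAdeleRing K := (x : AdeleRing (𝓞 K) K).1 with hxinf
  set xiinf : InfiniteAdeleRing K := ((x⁻¹ : ideleGroup K) : AdeleRing (𝓞 K) K).1 with hxiinf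
  have hinv : ∀ (y : ideleGroup K) (w : InfinitePlace K),
      ((y⁻¹ : ideleGroup K) : AdeleRing (𝓞 K) K).1 w = ((y : AdeleRing (𝓞 K) K).1 w)⁻¹ := by
    intro y w
    have h := congrFun (ideleGroup_val_inv_fst_mul y) w
    change ((y⁻¹ : ideleGroup K) : AdeleRing (𝓞 K) K).1 w * (y : AdeleRing (𝓞 K) K).1 w = 1 at h
    exact eq_inv_of_mul_eq_one_left h
  have hx0 : ∀ w : InfinitePlace K, xinf w ≠ 0 := by
    intro w
    have h := congrFun (ideleGroup_val_inv_fst_mul x) w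
    change xiinf w * xinf w = 1 at h
    exact right_ne_zero_of_mul_eq_one h
  have hxi : ∀ w : InfinitePlace K, xiinf w = (xinf w)⁻¹ := fun w => hinv x w
  have hxf0 : ∀ v : HeightOneSpectrum (𝓞 K), (x : AdeleRing (𝓞 K) K).2 v ≠ 0 :=
    ideleGroup_snd_ne_zero x
  -- the space `Y = (∏_{v ∈ S} K_v) × K_∞`, the target point and the four test maps
  let y₀ : (∀ v : S, v.1.adicCompletion K) × InfiniteAdeleRing K :=
    (fun v => (x : AdeleRing (𝓞 K) K).2 v.1, xinf)
  let f₁ : (∀ v : S, v.1.adicCompletion K) × InfiniteAdeleRing K → InfiniteAdeleRing K :=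
    fun p => fun w => xinf w * (p.2 w)⁻¹
  let f₂ : (∀ v : S, v.1.adicCompletion K) × InfiniteAdeleRing K → InfiniteAdeleRing K :=
    fun p => fun w => p.2 w * xiinf w
  let g : ∀ v : S, (∀ v : S, v.1.adicCompletion K) × InfiniteAdeleRing K → v.1.adicCompletion K :=
    fun v p => (x : AdeleRing (𝓞 K) K).2 v.1 * (p.1 v)⁻¹
  have hf₁ : ContinuousAt f₁ y₀ := by
    refine continuousAt_pi.2 fun w => ?_
    have hc : ContinuousAt (fun p : (∀ v : S, v.1.adicCompletion K) × InfiniteAdeleRing K => p.2 w)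
        y₀ := ((continuous_apply w).comp continuous_snd).continuousAt
    exact continuousAt_const.mul (hc.inv₀ (hx0 w))
  have hf₂ : ContinuousAt f₂ y₀ := by
    refine continuousAt_pi.2 fun w => ?_
    have hc : ContinuousAt (fun p : (∀ v : S, v.1.adicCompletion K) × InfiniteAdeleRing K => p.2 w)
        y₀ := ((continuous_apply w).comp continuous_snd).continuousAt
    exact hc.mul continuousAt_const
  have hg : ∀ v, ContinuousAt (g v) y₀ := by
    intro v
    have hc : ContinuousAt (fun p : (∀ v : S, v.1.adicCompletion K) × InfiniteAdeleRing K => p.1 v)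
        y₀ := ((continuous_apply v).comp continuous_fst).continuousAt
    exact continuousAt_const.mul (hc.inv₀ (hxf0 v.1))
  have hf₁y : f₁ y₀ = 1 := funext fun w => mul_inv_cancel₀ (hx0 w)
  have hf₂y : f₂ y₀ = 1 := funext fun w => by
    change xinf w * xiinf w = 1
    rw [hxi, mul_inv_cancel₀ (hx0 w)]
  have hgy : ∀ v, g v y₀ = 1 := fun v => mul_inv_cancel₀ (hxf0 v.1)
  -- congruence balls are neighbourhoods of `1`
  have hB : ∀ (v : HeightOneSpectrum (𝓞 K)) (m : ℕ),
      {c : v.adicCompletion K | Valued.v (c - 1) < WithZero.exp (-(m : ℤ))} ∈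
        𝓝 (1 : v.adicCompletion K) := by
    intro v m
    set z : v.adicCompletion K :=
      ((uniformizer K v : (v.adicCompletion K)ˣ) : v.adicCompletion K) ^ m with hzdef
    have hz : Valued.v z = WithZero.exp (-(m : ℤ)) := by
      rw [hzdef, map_pow, valued_uniformizer, ← WithZero.exp_nsmul]
      congr 1
      simp
    have hopen : IsOpen {c : v.adicCompletion K | Valued.v (c - 1) < Valued.v z} := by
      have h1 : IsOpen {y : v.adicCompletion K | Valued.v y < Valued.v z} := by
        simpa only [Valuation.restrict_lt_iff] using
          Valued.isOpen_ball (v.adicCompletion K) (Valued.v.restrict z)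
      exact h1.preimage (continuous_id.sub continuous_const)
    rw [← hz]
    refine hopen.mem_nhds ?_
    change Valued.v ((1 : v.adicCompletion K) - 1) < Valued.v z
    rw [sub_self, map_zero, hz]
    exact zero_lt_iff.2 WithZero.coe_ne_zero
  -- a non-empty set of infinite places, to force `a ≠ 0`
  obtain ⟨w₀⟩ : Nonempty (InfinitePlace K) := inferInstance
  have hO : {p : (∀ v : S, v.1.adicCompletion K) × InfiniteAdeleRing K | p.2 w₀ ≠ 0} ∈ 𝓝 y₀ :=
    (isOpen_ne_fun ((continuous_apply w₀).comp continuous_snd) continuous_const).mem_nhds (hx0 w₀)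
  -- the good neighbourhood of `y₀` and an `a ∈ K` in it
  have h𝒩 : f₁ ⁻¹' U₁ ∩ (f₂ ⁻¹' U₁ ∩ ({p | p.2 w₀ ≠ 0} ∩
      ⋂ v : S, g v ⁻¹' {c | Valued.v (c - 1) < WithZero.exp (-((e v.1 + 1 : ℕ) : ℤ))})) ∈ 𝓝 y₀ := by
    refine Filter.inter_mem (hf₁.preimage_mem_nhds (by rw [hf₁y]; exact hU₁))
      (Filter.inter_mem (hf₂.preimage_mem_nhds (by rw [hf₂y]; exact hU₁))
        (Filter.inter_mem hO ((Filter.iInter_mem).2 fun v => ?_)))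
    exact (hg v).preimage_mem_nhds (by rw [hgy]; exact hB v.1 _)
  obtain ⟨a, ha₁, ha₂, ha₃, ha₄⟩ := (denseRange_algebraMap_pi_prod S).mem_nhds h𝒩
  simp only [Set.mem_iInter, Set.mem_preimage, Set.mem_setOf_eq] at ha₁ ha₂ ha₃ ha₄
  have ha0 : a ≠ 0 := by
    rintro rfl
    exact ha₃ (by rw [map_zero]; rfl)
  -- the units built from `a` and `x`
  set A : Kˣ := Units.mk0 a ha0 with hA
  set X : ∀ v : HeightOneSpectrum (𝓞 K), (v.adicCompletion K)ˣ := fun v =>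
    Units.map (ideleGroup.finComp v) (toUnits x) with hX
  set c : ∀ v : HeightOneSpectrum (𝓞 K), (v.adicCompletion K)ˣ := fun v =>
    X v * (globalToLocalUnits v A)⁻¹ with hc
  set Xinf : (InfiniteAdeleRing K)ˣ := Units.map ideleGroup.infComp (toUnits x) with hXinf
  set u : ideleGroup K :=
    infiniteIdeles K (Xinf * (globalToInfiniteUnits K A)⁻¹) * ∏ v ∈ S, localUnits v (c v) with hu
  -- components of `u`
  have hcv : ∀ v, (c v : v.adicCompletion K) =
      (x : AdeleRing (𝓞 K) K).2 v * (algebraMap K (v.adicCompletion K) a)⁻¹ := fun v => by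
    rw [hc]; dsimp only; rw [Units.val_mul, Units.val_inv_eq_inv_val]; rfl
  have hu1 : (u : AdeleRing (𝓞 K) K).1 = f₁ ((fun v : S => algebraMap K (v.1.adicCompletion K) a),
      algebraMap K (InfiniteAdeleRing K) a) := by
    rw [hu, ideleGroup_val_fst_mul, fst_prod_localUnits, mul_one, infiniteIdeles_fst]
    funext w
    change xinf w * algebraMap K (InfiniteAdeleRing K) (a⁻¹ : K) w =
      xinf w * (algebraMap K (InfiniteAdeleRing K) a w)⁻¹
    rw [InfiniteAdeleRing.algebraMap_apply, InfiniteAdeleRing.algebraMap_apply,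
      ← InfinitePlace.Completion.algebraMap_apply, ← InfinitePlace.Completion.algebraMap_apply,
      map_inv₀]
  have hu2 : ∀ v, (u : AdeleRing (𝓞 K) K).2 v =
      if v ∈ S then (x : AdeleRing (𝓞 K) K).2 v * (algebraMap K (v.adicCompletion K) a)⁻¹
      else 1 := fun v => by
    rw [hu, ideleGroup_val_snd_mul, infiniteIdeles_snd, one_mul, snd_prod_localUnits]
    split_ifs
    · exact hcv v
    · rfl
  have hu1w : ∀ w, (u : AdeleRing (𝓞 K) K).1 w = xinf w * (algebraMap K (InfiniteAdeleRing K) a w)⁻¹ :=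
    fun w => by rw [hu1]
  have haw : ∀ w : InfinitePlace K, algebraMap K (InfiniteAdeleRing K) a w ≠ 0 := fun w => by
    rw [InfiniteAdeleRing.algebraMap_apply, ← InfinitePlace.Completion.algebraMap_apply]
    exact (map_ne_zero _).2 ha0
  have hui1 : ((u⁻¹ : ideleGroup K) : AdeleRing (𝓞 K) K).1 =
      f₂ ((fun v : S => algebraMap K (v.1.adicCompletion K) a),
        algebraMap K (InfiniteAdeleRing K) a) := by
    funext w
    rw [hinv, hu1w]
    change (xinf w * (algebraMap K (InfiniteAdeleRing K) a w)⁻¹)⁻¹ =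
      algebraMap K (InfiniteAdeleRing K) a w * xiinf w
    rw [mul_inv_rev, inv_inv, hxi]
  -- `u` lies in the prescribed neighbourhood of `1`
  have huW : u ∈ χ ⁻¹' W := by
    refine hTe u (by rw [hu1]; exact ha₁) (by rw [hui1]; exact ha₂) (fun v => ?_) (fun v hv => ?_)
    · rw [hu2]
      split_ifs with hv
      · have hlt := ha₄ ⟨v, hv⟩
        change Valued.v ((x : AdeleRing (𝓞 K) K).2 v * (algebraMap K (v.adicCompletion K) a)⁻¹ - 1) <
          _ at hlt
        have h1 : Valued.v ((x : AdeleRing (𝓞 K) K).2 v * (algebraMap K (v.adicCompletion K) a)⁻¹ - 1) <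
            Valued.v (1 : v.adicCompletion K) := by
          rw [map_one, ← WithZero.exp_zero]
          exact hlt.trans_le (WithZero.exp_le_exp.2 (by push_cast; omega))
        rw [Valuation.map_eq_of_sub_lt _ h1, map_one]
      · exact map_one _
    · rw [hu2]
      split_ifs with hvS
      · have hlt := ha₄ ⟨v, hvS⟩
        change Valued.v ((x : AdeleRing (𝓞 K) K).2 v * (algebraMap K (v.adicCompletion K) a)⁻¹ - 1) <
          _ at hlt
        exact hlt.le.trans (WithZero.exp_le_exp.2 (by push_cast; omega))
      · rw [sub_self, map_zero]
        exact zero_le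
  -- `x = (a) · u · g` with `χ g = 1`
  have haA : ((A : Kˣ) : K) = a := rfl
  set gI : ideleGroup K := (principalIdele K A * u)⁻¹ * x with hgI
  have hχg : χ gI = 1 := by
    refine ContinuousMonoidHom.idele_eq_one_of_fst_eq_one χ (S := (S : Set (HeightOneSpectrum (𝓞 K))))
      (fun v hv => h v (by simpa using hv)) gI ?_ ?_
    · funext w
      change (((principalIdele K A * u)⁻¹ : ideleGroup K) : AdeleRing (𝓞 K) K).1 w *
          xinf w = 1
      rw [hinv]
      change (algebraMap K (InfiniteAdeleRing K) (A : K) w * (u : AdeleRing (𝓞 K) K).1 w)⁻¹ *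
        xinf w = 1
      rw [haA, hu1w, mul_left_comm, mul_inv_cancel₀ (haw w), mul_one, inv_mul_cancel₀ (hx0 w)]
    · intro v hv
      have hvS : v ∈ S := by simpa using hv
      have ha0v : algebraMap K (v.adicCompletion K) a ≠ 0 := (map_ne_zero _).2 ha0
      rw [hgI, ideleGroup_val_snd_mul, ideleGroup_val_inv_snd, ideleGroup_val_snd_mul,
        principalIdele_snd, haA, hu2, if_pos hvS, mul_left_comm, mul_inv_cancel₀ ha0v, mul_one,
        inv_mul_cancel₀ (hxf0 v)]
  have hx : x = principalIdele K A * u * gI := by rw [hgI, mul_inv_cancel_left]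
  rw [hx, map_mul, map_mul, hprinc _ (principalIdele_mem A), one_mul, hχg, mul_one]
  exact huW


/-- **Rigidity**: two continuous characters of `𝕀_K` trivial on `Kˣ` which agree on `K_vˣ ⊆ 𝕀_K` for
all finite `v` outside a finite set are equal. [cite: CasselsFrohlichANT1967, Ch. VII §4 Prop. 4.1 (proof)] -/
theorem ContinuousMonoidHom.idele_eq_of_forall_localUnits (χ₁ χ₂ : ideleGroup K →ₜ* G)
    (h₁ : ∀ x ∈ principalIdeles K, χ₁ x = 1) (h₂ : ∀ x ∈ principalIdeles K, χ₂ x = 1)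
    {S : Finset (HeightOneSpectrum (𝓞 K))}
    (h : ∀ v ∉ S, ∀ u : (v.adicCompletion K)ˣ, χ₁ (localUnits v u) = χ₂ (localUnits v u)) : χ₁ = χ₂ := by
  have h1 : χ₁ * χ₂⁻¹ = 1 := by
    refine ContinuousMonoidHom.idele_eq_one_of_forall_localUnits (χ₁ * χ₂⁻¹) (fun x hx => ?_) (S := S) fun v hv u => ?_
    · rw [ContinuousMonoidHom.mul_apply, h₁ x hx]
      change (1 : G) * (χ₂ x)⁻¹ = 1
      rw [h₂ x hx, inv_one, mul_one]
    · rw [ContinuousMonoidHom.mul_apply, h v hv u]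
      change χ₂ (localUnits v u) * (χ₂ (localUnits v u))⁻¹ = 1
      rw [mul_inv_cancel]
  exact mul_inv_eq_one.1 h1

end Literature.NumberTheory.GaloisRepresentations

end
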